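/-
Copyright (c) 2026. All rights reserved.
Released under Apache 2.0 license as described in the file LICENSE.
Authors: HodgeCM publication cell (pub-hodgecm), GR lane, seat GR-1 (`pub-hodgecm-own-real34`).
-/
import Literature.NumberTheory.GelbartRogawski1991.DoubledUnitaryArchSiegelSignReps
import Literature.NumberTheory.GelbartRogawski1991.DoubledUnitaryGlobalSplittingDataGen
import HarnessLib

/-!
# The matrix of the Cayley–Levi element of an orthogonal sign pattern: `mA r = e₂ (r ⊕ r) e₂`; the pair representatives

Topic `NumberTheory/GelbartRogawski1991`; namespace `Literature.NumberTheory.GelbartRogawski1991.GRConstructionGen`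
(telescope of `DoubledUnitaryGlobalSplittingDataGen`).  KERNEL only: proved theorems; no definition, no named fact, no
`sorry`.  For the Cayley–Levi homomorphism `mA` at the doubled data (`DoubledUnitaryArchSiegelSignReps`,
`UnitaryGroupArchSiegelLeviCayley`: `2 · e₂⁻¹ (mA r) e₂ = C · diag(r, τ⁻¹ (c⊗1)(r⁻¹)ᵀ τ) · C`) and a pattern `r ∈ GL_n(E ⊗ ℝ)` that is
`(c ⊗ 1)`-FIXED and `S`-ORTHOGONAL (`rᵀ S r = S`, `S = T ⊗ 1`, `T = gramR`), the Cayley conjugate collapses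
(`DoubledUnitary.cayley_levi_cayley_eq_two_smul_of_orthogonal`):

* **`coe_leviCayley_of_orthogonal`** — `mA r = e₂ (r ⊕ r) e₂` as a matrix; hence its coordinates: at a real place `w`,
  `(mA r)_w = e₂ (ρ(w) ⊕ ρ(w)) e₂` and at a complex place `(mA r)_w = 1`, for `r = signPatternGL ρ`
  (`map_evalR_leviCayley_of_orthogonal`, `map_evalC_leviCayley_of_orthogonal`);
* **the PAIR pattern** `ρ = mulSingle w_k ε · mulSingle (c⁻¹w_k) ε` is `(c ⊗ 1)`-fixed (`map_conjMixed_signPatternGL_pair`: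
  `c` swaps `w_k ↔ c⁻¹ w_k` and fixes the value `1` elsewhere), and is `S`-orthogonal as soon as `εᵀ S_w ε = S_w` at the two
  places (`transpose_mul_mul_signPatternGL_pair`) — automatic at DIAGONAL Gram data `TV = diag dV`, `TW = diag dW` for a
  diagonal sign `ε = diag d` (`gramR_diagonal_isDiag`-type lemma `transpose_mul_mul_of_diagonal`);
* so at diagonal data **`map_evalR_leviCayley_pair`**: `(q₀ k)_{w_j} = diagonal (εR j)`, `εR j = (d ⊕ d) ∘ e₂⁻¹` if `j = k` and
  `1` otherwise — symmetric under `inl i ↔ inr i` and `±1`-valued — and **`map_evalC_leviCayley_pair`**: `(q₀ k)_w = 1` at every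
  complex `w`: exactly the hypotheses `hR`, `hsym`, `hεR`, `hC` of GR-2's
  `DoubledWeilRepresentationArchDeltaSign.conj_archWeilSection3D_apply_zero_of_sign` (origin value `1` at `q₀ k`).

([Kudla1994, §3]; [HarrisKudlaSweet1996, §1 (1.11)–(1.12)]; archimedean places of type (ii) of [GelbartRogawski1991,
Prop. 3.1.1].)  Written for the stage-1 cell `pub-hodgecm` (seat GR-1); nothing here is a claim of the manuscripts adjudicated there.

## References

* S. S. Kudla, Israel J. Math. 87 (1994) 361–401, §3 [Kudla1994].
* M. Harris, S. S. Kudla, W. J. Sweet, J. Amer. Math. Soc. 9 (1996), §1 (1.11)–(1.12) [HarrisKudlaSweet1996].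
* S. Gelbart, J. Rogawski, Invent. Math. 105 (1991), §3.1 Prop. 3.1.1 p. 455 [GelbartRogawski1991].
-/

set_option autoImplicit false

noncomputable section

open scoped Classical
open scoped Matrix MatrixGroups Kronecker
open NumberField NumberField.InfinitePlace NumberField.mixedEmbedding IsDedekindDomain
open Literature.NumberTheory.Automorphic Literature.NumberTheory.Automorphic.UnitaryGroup
open Literature.NumberTheory.Weil1964
open Literature.NumberTheory.GaloisRepresentations
open Literature.RepresentationTheory.HeisenbergGroup
open Literature.NumberTheory.GelbartRogawski1991.UnitaryDualPair.ArchSplitting.QuadExt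

namespace Literature.NumberTheory.GelbartRogawski1991.GRConstructionGen

open UnitaryDualPair

variable (F : Type) [Field F] [NumberField F] (E : Type) [Field E] [NumberField E] [Algebra F E]
  [Algebra.IsQuadraticExtension F E]
variable (c : E ≃ₐ[F] E) {δ : E} (hcδ : c δ = -δ) (hδ : δ ≠ 0) {d : F} (hd : δ * δ = algebraMap F E d)
variable {N M n : ℕ} (e : Fin N × Fin M ≃ Fin n)
  (TV : Matrix (Fin N) (Fin N) F) (hV : TV.IsSymm) (hVd : IsUnit TV.det)
  (TW : Matrix (Fin M) (Fin M) F) (hW : TW.IsSymm) (hWd : IsUnit TW.det)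
variable (mA : GL (Fin n) (mixedSpace E) →* arch F E c (n + n) (hermD F E e TV TW))
  (h2 : ∀ r, (2 : mixedSpace E) • Matrix.reindex (e₂ (n := n)).symm (e₂ (n := n)).symm
        (((mA r : arch F E c (n + n) (hermD F E e TV TW)) : GL (Fin (n + n)) (mixedSpace E)) :
          Matrix (Fin (n + n)) (Fin (n + n)) (mixedSpace E)) =
      Matrix.fromBlocks (1 : Matrix (Fin n) (Fin n) (mixedSpace E)) 1 1 (-1) *
        Matrix.fromBlocks (r : Matrix (Fin n) (Fin n) (mixedSpace E)) 0 0
          ((((gramR F e TV TW).map (algebraMap F E)).map (mixedEmbedding E) +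
              ((gramR F e TV TW).map (algebraMap F E)).map (mixedEmbedding E))⁻¹ *
            (((r⁻¹ : GL (Fin n) (mixedSpace E)) : Matrix (Fin n) (Fin n) (mixedSpace E)).map (conjMixed F E c))ᵀ *
            (((gramR F e TV TW).map (algebraMap F E)).map (mixedEmbedding E) +
              ((gramR F e TV TW).map (algebraMap F E)).map (mixedEmbedding E))) *
        Matrix.fromBlocks (1 : Matrix (Fin n) (Fin n) (mixedSpace E)) 1 1 (-1))

/-! ## §1 `mA r = e₂ (r ⊕ r) e₂` for a `(c ⊗ 1)`-fixed `S`-orthogonal `r` -/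

omit [NumberField F] [NumberField E] in
/-- `2` is a unit of `E ⊗ ℝ`. [folklore] -/
private theorem isUnit_two_mixedSpace₄ : IsUnit (2 : mixedSpace E) := by
  have : (2 : mixedSpace E) = algebraMap ℝ (mixedSpace E) 2 := by rw [map_ofNat]
  rw [this]
  exact (isUnit_iff_ne_zero.2 two_ne_zero).map _

omit [NumberField F] [NumberField E] [Algebra.IsQuadraticExtension F E] in
include h2 hVd hWd in
/-- **`mA r = e₂ (r ⊕ r) e₂`** for `r` with `(c ⊗ 1) r = r` and `rᵀ (T ⊗ 1) r = T ⊗ 1` (`T = gramR`): the Cayley conjugate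
`C · diag(r, τ⁻¹ (c⊗1)(r⁻¹)ᵀ τ) · C` is `2 · (r ⊕ r)`. [cite: HarrisKudlaSweet1996, §1 (1.11)] -/
theorem coe_leviCayley_of_orthogonal (r : GL (Fin n) (mixedSpace E))
    (hrσ : ((r : GL (Fin n) (mixedSpace E)) : Matrix (Fin n) (Fin n) (mixedSpace E)).map (conjMixed F E c) = r)
    (hrS : ((r : GL (Fin n) (mixedSpace E)) : Matrix (Fin n) (Fin n) (mixedSpace E))ᵀ *
        ((gramR F e TV TW).map (algebraMap F E)).map (mixedEmbedding E) * r =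
      ((gramR F e TV TW).map (algebraMap F E)).map (mixedEmbedding E)) :
    (((mA r : arch F E c (n + n) (hermD F E e TV TW)) : GL (Fin (n + n)) (mixedSpace E)) :
        Matrix (Fin (n + n)) (Fin (n + n)) (mixedSpace E)) =
      Matrix.reindex (e₂ (n := n)) (e₂ (n := n))
        (Matrix.fromBlocks ((r : GL (Fin n) (mixedSpace E)) : Matrix (Fin n) (Fin n) (mixedSpace E)) 0 0 r) := by
  have hSu : IsUnit (((gramR F e TV TW).map (algebraMap F E)).map (mixedEmbedding E)).det := by
    rw [Matrix.map_map, ← RingHom.coe_comp, ← RingHom.mapMatrix_apply, ← RingHom.map_det]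
    exact (isUnit_det_gram F e hVd hWd).map _
  have key := h2 r
  rw [DoubledUnitary.cayley_levi_cayley_eq_two_smul_of_orthogonal (conjMixed F E c) (isUnit_two_mixedSpace₄ E) hSu r hrσ hrS]
    at key
  have h := DoubledUnitary.eq_of_two_smul_eq (isUnit_two_mixedSpace₄ E) key
  have h' := congrArg (Matrix.reindex (e₂ (n := n)) (e₂ (n := n))) h
  rw [← Matrix.reindex_symm, Equiv.apply_symm_apply] at h'
  exact h'

omit [NumberField F] [NumberField E] [Algebra.IsQuadraticExtension F E] in
include h2 hVd hWd in
/-- real coordinates: `(mA (signPatternGL ρ))_w = e₂ (ρ(w) ⊕ ρ(w)) e₂` (same hypotheses). [cite: Kudla1994, §3] -/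
theorem map_evalR_leviCayley_of_orthogonal (ρ : {w : InfinitePlace E // w.IsReal} → GL (Fin n) ℝ)
    (hrσ : ((signPatternGL E ρ : GL (Fin n) (mixedSpace E)) : Matrix (Fin n) (Fin n) (mixedSpace E)).map (conjMixed F E c) =
      signPatternGL E ρ)
    (hrS : ((signPatternGL E ρ : GL (Fin n) (mixedSpace E)) : Matrix (Fin n) (Fin n) (mixedSpace E))ᵀ *
        ((gramR F e TV TW).map (algebraMap F E)).map (mixedEmbedding E) * signPatternGL E ρ =
      ((gramR F e TV TW).map (algebraMap F E)).map (mixedEmbedding E))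
    (w : {w : InfinitePlace E // w.IsReal}) :
    (((mA (signPatternGL E ρ) : arch F E c (n + n) (hermD F E e TV TW)) : GL (Fin (n + n)) (mixedSpace E)) :
        Matrix (Fin (n + n)) (Fin (n + n)) (mixedSpace E)).map (evalR E w) =
      Matrix.reindex (e₂ (n := n)) (e₂ (n := n))
        (Matrix.fromBlocks ((ρ w : GL (Fin n) ℝ) : Matrix (Fin n) (Fin n) ℝ) 0 0 (ρ w)) := by
  rw [coe_leviCayley_of_orthogonal F E c e TV hVd TW hWd mA h2 _ hrσ hrS]
  simp only [Matrix.reindex_apply, ← Matrix.submatrix_map, Matrix.fromBlocks_map, Matrix.map_zero _ (map_zero _),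
    coe_signPatternGL, map_evalR_signPatternMat]

omit [NumberField F] [NumberField E] [Algebra.IsQuadraticExtension F E] in
include h2 hVd hWd in
/-- complex coordinates: `(mA (signPatternGL ρ))_w = 1` (same hypotheses). [cite: Kudla1994, §3] -/
theorem map_evalC_leviCayley_of_orthogonal (ρ : {w : InfinitePlace E // w.IsReal} → GL (Fin n) ℝ)
    (hrσ : ((signPatternGL E ρ : GL (Fin n) (mixedSpace E)) : Matrix (Fin n) (Fin n) (mixedSpace E)).map (conjMixed F E c) =
      signPatternGL E ρ)
    (hrS : ((signPatternGL E ρ : GL (Fin n) (mixedSpace E)) : Matrix (Fin n) (Fin n) (mixedSpace E))ᵀ *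
        ((gramR F e TV TW).map (algebraMap F E)).map (mixedEmbedding E) * signPatternGL E ρ =
      ((gramR F e TV TW).map (algebraMap F E)).map (mixedEmbedding E))
    (w : {w : InfinitePlace E // w.IsComplex}) :
    (((mA (signPatternGL E ρ) : arch F E c (n + n) (hermD F E e TV TW)) : GL (Fin (n + n)) (mixedSpace E)) :
        Matrix (Fin (n + n)) (Fin (n + n)) (mixedSpace E)).map (evalC E w) = 1 := by
  rw [coe_leviCayley_of_orthogonal F E c e TV hVd TW hWd mA h2 _ hrσ hrS]
  simp only [Matrix.reindex_apply, ← Matrix.submatrix_map, Matrix.fromBlocks_map, Matrix.map_zero _ (map_zero _),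
    coe_signPatternGL, map_evalC_signPatternMat, Matrix.fromBlocks_one, Matrix.submatrix_one_equiv]

/-! ## §2 The pair pattern is `(c ⊗ 1)`-fixed -/

section Pair

variable {κ : Type*} (wOf : κ → {w : InfinitePlace E // w.IsReal}) (eκ : κ ⊕ κ ≃ {w : InfinitePlace E // w.IsReal})
  (he₁ : ∀ k, eκ (Sum.inl k) = wOf k) (he₂ : ∀ k, eκ (Sum.inr k) = ⟨c⁻¹ • (wOf k).1, isReal_smul_iff.mpr (wOf k).2⟩)

omit [NumberField F] [NumberField E] [Algebra.IsQuadraticExtension F E] in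
include he₁ he₂ in
/-- the pair pattern takes the same value at `w` and `c⁻¹ w` (for `c² = 1`). [cite: Kudla1994, §3] -/
theorem pair_apply_smul (hcc : c * c = 1) (ε : GL (Fin n) ℝ) (k : κ) (w : {w : InfinitePlace E // w.IsReal}) :
    (Pi.mulSingle (wOf k) ε * Pi.mulSingle (⟨c⁻¹ • (wOf k).1, isReal_smul_iff.mpr (wOf k).2⟩ : {w : InfinitePlace E // w.IsReal}) ε :
        {w : InfinitePlace E // w.IsReal} → GL (Fin n) ℝ) ⟨c⁻¹ • w.1, isReal_smul_iff.mpr w.2⟩ =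
      (Pi.mulSingle (wOf k) ε * Pi.mulSingle (⟨c⁻¹ • (wOf k).1, isReal_smul_iff.mpr (wOf k).2⟩ : {w : InfinitePlace E // w.IsReal}) ε :
        {w : InfinitePlace E // w.IsReal} → GL (Fin n) ℝ) w := by
  have hcinv : c⁻¹ = c := inv_eq_of_mul_eq_one_right hcc
  have hcc' : ∀ v : InfinitePlace E, c⁻¹ • c⁻¹ • v = v := fun v => by
    rw [smul_smul, hcinv, hcc, one_smul]
  obtain ⟨j, hj⟩ | ⟨j, hj⟩ : (∃ j, eκ (Sum.inl j) = w) ∨ (∃ j, eκ (Sum.inr j) = w) := by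
    rcases h : eκ.symm w with j | j
    · exact Or.inl ⟨j, by rw [← h, Equiv.apply_symm_apply]⟩
    · exact Or.inr ⟨j, by rw [← h, Equiv.apply_symm_apply]⟩
  · -- `w = w_j`
    rw [he₁] at hj
    subst hj
    obtain ⟨h1, h2'⟩ := pair_apply F E c wOf eκ he₁ he₂ ε j k
    rw [h1, h2']
  · -- `w = c⁻¹ w_j`, `c⁻¹ w = w_j`
    rw [he₂] at hj
    subst hj
    obtain ⟨h1, h2'⟩ := pair_apply F E c wOf eκ he₁ he₂ ε j k
    have hw : (⟨c⁻¹ • (c⁻¹ • (wOf j).1), isReal_smul_iff.mpr (isReal_smul_iff.mpr (wOf j).2)⟩ : {w : InfinitePlace E // w.IsReal}) =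
        wOf j := Subtype.ext (hcc' _)
    rw [hw, h1, h2']

omit [NumberField F] [NumberField E] [Algebra.IsQuadraticExtension F E] in
include he₁ he₂ in
/-- **the pair pattern is `(c ⊗ 1)`-fixed**: `(c ⊗ 1)` reads the real coordinate `w` at `c⁻¹ w` (same value) and the complex
coordinates through ring maps (value `1`). [cite: Kudla1994, §3] -/
theorem map_conjMixed_signPatternGL_pair (hcc : c * c = 1) (ε : GL (Fin n) ℝ) (k : κ) :
    ((signPatternGL E (Pi.mulSingle (wOf k) ε *
        Pi.mulSingle (⟨c⁻¹ • (wOf k).1, isReal_smul_iff.mpr (wOf k).2⟩ : {w : InfinitePlace E // w.IsReal}) ε) :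
          GL (Fin n) (mixedSpace E)) : Matrix (Fin n) (Fin n) (mixedSpace E)).map (conjMixed F E c) =
      signPatternGL E (Pi.mulSingle (wOf k) ε *
        Pi.mulSingle (⟨c⁻¹ • (wOf k).1, isReal_smul_iff.mpr (wOf k).2⟩ : {w : InfinitePlace E // w.IsReal}) ε) := by
  refine matrix_eq_of_map_eval_eq E (fun w => ?_) (fun w => ?_)
  · rw [Matrix.map_map, coe_signPatternGL, map_evalR_signPatternMat]
    have hφ : (⇑(evalR E w) ∘ ⇑(conjMixed F E c) : mixedSpace E → ℝ) = ⇑(evalR E ⟨c⁻¹ • w.1, isReal_smul_iff.mpr w.2⟩) :=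
      funext fun x => by rw [Function.comp_apply, evalR_apply, evalR_apply, conjMixed_fst_eq]
    rw [hφ, map_evalR_signPatternMat, pair_apply_smul F E c wOf eκ he₁ he₂ hcc ε k w]
  · rw [Matrix.map_map, coe_signPatternGL, map_evalC_signPatternMat]
    set ψ : ℂ →+* ℂ := (Completion.ringEquivComplexOfIsComplex w.2).toRingHom.comp
      ((galInfiniteCompletionMap c (smul_inv_smul c w.1)).comp
        (Completion.ringEquivComplexOfIsComplex (isComplex_smul_iff.mpr w.2 : IsComplex (c⁻¹ • w.1))).symm.toRingHom) with hψ
    have hφ : (⇑(evalC E w) ∘ ⇑(conjMixed F E c) : mixedSpace E → ℂ) =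
        ⇑ψ ∘ ⇑(evalC E ⟨c⁻¹ • w.1, isComplex_smul_iff.mpr w.2⟩) :=
      funext fun x => by rw [Function.comp_apply, Function.comp_apply, evalC_apply, evalC_apply, conjMixed_snd_apply]; rfl
    rw [hφ, ← Matrix.map_map, map_evalC_signPatternMat, Matrix.map_one ψ (map_zero _) (map_one _)]

end Pair

/-! ## §3 Diagonal Gram data: `S`-orthogonality of diagonal signs; the pair representative's coordinates -/

section Diagonal

variable (dV : Fin N → F) (dW : Fin M → F)

omit [NumberField F] [NumberField E] [Algebra.IsQuadraticExtension F E] in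
/-- at diagonal Gram data `T = gramR e (diag dV) (diag dW)` is diagonal, so `T ⊗ 1` commutes with every diagonal sign pattern:
`rᵀ (T ⊗ 1) r = T ⊗ 1` for `r = signPatternGL ρ`, `ρ w = diagonal (d w)`, `d w i ^ 2 = 1`. [cite: Kudla1994, §3] -/
theorem transpose_mul_mul_signPatternGL_of_diagonal (dρ : {w : InfinitePlace E // w.IsReal} → Fin n → ℝ)
    (hd : ∀ w i, dρ w i * dρ w i = 1) (ρ : {w : InfinitePlace E // w.IsReal} → GL (Fin n) ℝ)
    (hρ : ∀ w, ((ρ w : GL (Fin n) ℝ) : Matrix (Fin n) (Fin n) ℝ) = Matrix.diagonal (dρ w)) :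
    ((signPatternGL E ρ : GL (Fin n) (mixedSpace E)) : Matrix (Fin n) (Fin n) (mixedSpace E))ᵀ *
        ((gramR F e (Matrix.diagonal dV) (Matrix.diagonal dW)).map (algebraMap F E)).map (mixedEmbedding E) * signPatternGL E ρ =
      ((gramR F e (Matrix.diagonal dV) (Matrix.diagonal dW)).map (algebraMap F E)).map (mixedEmbedding E) := by
  -- `T` is diagonal
  have hT : gramR F e (Matrix.diagonal dV) (Matrix.diagonal dW) = Matrix.diagonal (fun i => dV (e.symm i).1 * dW (e.symm i).2) := by
    show Matrix.reindex e e (Matrix.diagonal dV ⊗ₖ Matrix.diagonal dW) = _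
    rw [Matrix.diagonal_kronecker_diagonal, Matrix.reindex_apply, Matrix.submatrix_diagonal_equiv]
    rfl
  set t : Fin n → mixedSpace E := fun i => mixedEmbedding E (algebraMap F E (dV (e.symm i).1 * dW (e.symm i).2)) with ht
  have hS : ((gramR F e (Matrix.diagonal dV) (Matrix.diagonal dW)).map (algebraMap F E)).map (mixedEmbedding E) =
      Matrix.diagonal t := by
    rw [hT, Matrix.diagonal_map (map_zero _), Matrix.diagonal_map (map_zero _)]
  rw [hS]
  refine matrix_eq_of_map_eval_eq E (fun w => ?_) (fun w => ?_)
  · rw [Matrix.map_mul, Matrix.map_mul, Matrix.transpose_map, coe_signPatternGL, map_evalR_signPatternMat, hρ,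
      Matrix.diagonal_map (map_zero _), Matrix.diagonal_transpose, Matrix.diagonal_mul_diagonal, Matrix.diagonal_mul_diagonal]
    refine congrArg Matrix.diagonal (funext fun i => ?_)
    rw [mul_comm (dρ w i), mul_assoc, hd, mul_one]
  · rw [Matrix.map_mul, Matrix.map_mul, Matrix.transpose_map, coe_signPatternGL, map_evalC_signPatternMat, Matrix.transpose_one,
      Matrix.one_mul, Matrix.mul_one]

variable {κ : Type*} (wOf : κ → {w : InfinitePlace E // w.IsReal}) (eκ : κ ⊕ κ ≃ {w : InfinitePlace E // w.IsReal})
  (he₁ : ∀ k, eκ (Sum.inl k) = wOf k) (he₂ : ∀ k, eκ (Sum.inr k) = ⟨c⁻¹ • (wOf k).1, isReal_smul_iff.mpr (wOf k).2⟩)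

omit [NumberField F] [NumberField E] [Algebra.IsQuadraticExtension F E] in
include he₁ he₂ in
/-- the pair pattern with a diagonal sign `ε = diag dε` is diagonal-valued at every real place: `diag dε` at `w_k`, `c⁻¹ w_k`,
`1` elsewhere. [cite: Kudla1994, §3] -/
theorem pair_apply_eq_diagonal (ε : GL (Fin n) ℝ) (dε : Fin n → ℝ)
    (hεd : ((ε : GL (Fin n) ℝ) : Matrix (Fin n) (Fin n) ℝ) = Matrix.diagonal dε) (k : κ) (w : {w : InfinitePlace E // w.IsReal}) :
    ∃ δw : Fin n → ℝ, (∀ i, δw i = dε i ∨ δw i = 1) ∧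
      (((Pi.mulSingle (wOf k) ε *
          Pi.mulSingle (⟨c⁻¹ • (wOf k).1, isReal_smul_iff.mpr (wOf k).2⟩ : {w : InfinitePlace E // w.IsReal}) ε :
          {w : InfinitePlace E // w.IsReal} → GL (Fin n) ℝ) w : GL (Fin n) ℝ) : Matrix (Fin n) (Fin n) ℝ) = Matrix.diagonal δw := by
  obtain ⟨j, hj⟩ | ⟨j, hj⟩ : (∃ j, eκ (Sum.inl j) = w) ∨ (∃ j, eκ (Sum.inr j) = w) := by
    rcases h : eκ.symm w with j | j
    · exact Or.inl ⟨j, by rw [← h, Equiv.apply_symm_apply]⟩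
    · exact Or.inr ⟨j, by rw [← h, Equiv.apply_symm_apply]⟩
  · rw [he₁] at hj
    subst hj
    obtain ⟨h1, -⟩ := pair_apply F E c wOf eκ he₁ he₂ ε j k
    rw [h1]
    by_cases hjk : j = k
    · exact ⟨dε, fun i => Or.inl rfl, by rw [if_pos hjk, hεd]⟩
    · exact ⟨fun _ => 1, fun i => Or.inr rfl, by rw [if_neg hjk, Units.val_one, Matrix.diagonal_one]⟩
  · rw [he₂] at hj
    subst hj
    obtain ⟨-, h2'⟩ := pair_apply F E c wOf eκ he₁ he₂ ε j k
    rw [h2']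
    by_cases hjk : j = k
    · exact ⟨dε, fun i => Or.inl rfl, by rw [if_pos hjk, hεd]⟩
    · exact ⟨fun _ => 1, fun i => Or.inr rfl, by rw [if_neg hjk, Units.val_one, Matrix.diagonal_one]⟩

omit [NumberField F] [NumberField E] [Algebra.IsQuadraticExtension F E] in
include he₁ he₂ in
/-- **the pair representative at DIAGONAL Gram data, real coordinates**: for `ε = diag dε` (`dε i² = 1`) and the Cayley–Levi
homomorphism `mA` at `TV = diag dV`, `TW = diag dW`:
`(q₀ k)_{w_j} = diagonal (((if j = k then dε else 1) ⊕ (if j = k then dε else 1)) ∘ e₂⁻¹)` — a symmetric `±1` sign diagonal (the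
`hR`/`hsym`/`hεR` data of `conj_archWeilSection3D_apply_zero_of_sign`). [cite: Kudla1994, §3] [cite: HarrisKudlaSweet1996, §1 (1.11)] -/
theorem map_evalR_leviCayley_pair (hcc : c * c = 1) (hdV : IsUnit (Matrix.diagonal dV).det) (hdW : IsUnit (Matrix.diagonal dW).det)
    (mA : GL (Fin n) (mixedSpace E) →* arch F E c (n + n) (hermD F E e (Matrix.diagonal dV) (Matrix.diagonal dW)))
    (h2 : ∀ r, (2 : mixedSpace E) • Matrix.reindex (e₂ (n := n)).symm (e₂ (n := n)).symm
        (((mA r : arch F E c (n + n) (hermD F E e (Matrix.diagonal dV) (Matrix.diagonal dW))) : GL (Fin (n + n)) (mixedSpace E)) :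
          Matrix (Fin (n + n)) (Fin (n + n)) (mixedSpace E)) =
      Matrix.fromBlocks (1 : Matrix (Fin n) (Fin n) (mixedSpace E)) 1 1 (-1) *
        Matrix.fromBlocks (r : Matrix (Fin n) (Fin n) (mixedSpace E)) 0 0
          ((((gramR F e (Matrix.diagonal dV) (Matrix.diagonal dW)).map (algebraMap F E)).map (mixedEmbedding E) +
              ((gramR F e (Matrix.diagonal dV) (Matrix.diagonal dW)).map (algebraMap F E)).map (mixedEmbedding E))⁻¹ *
            (((r⁻¹ : GL (Fin n) (mixedSpace E)) : Matrix (Fin n) (Fin n) (mixedSpace E)).map (conjMixed F E c))ᵀ *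
            (((gramR F e (Matrix.diagonal dV) (Matrix.diagonal dW)).map (algebraMap F E)).map (mixedEmbedding E) +
              ((gramR F e (Matrix.diagonal dV) (Matrix.diagonal dW)).map (algebraMap F E)).map (mixedEmbedding E))) *
        Matrix.fromBlocks (1 : Matrix (Fin n) (Fin n) (mixedSpace E)) 1 1 (-1))
    (ε : GL (Fin n) ℝ) (dε : Fin n → ℝ) (hεd : ((ε : GL (Fin n) ℝ) : Matrix (Fin n) (Fin n) ℝ) = Matrix.diagonal dε)
    (hdε : ∀ i, dε i * dε i = 1) (k j : κ) :
    (((mA (signPatternGL E (Pi.mulSingle (wOf k) ε *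
        Pi.mulSingle (⟨c⁻¹ • (wOf k).1, isReal_smul_iff.mpr (wOf k).2⟩ : {w : InfinitePlace E // w.IsReal}) ε)) :
          arch F E c (n + n) (hermD F E e (Matrix.diagonal dV) (Matrix.diagonal dW))) : GL (Fin (n + n)) (mixedSpace E)) :
          Matrix (Fin (n + n)) (Fin (n + n)) (mixedSpace E)).map (evalR E (wOf j)) =
      Matrix.diagonal (fun i => Sum.elim (if j = k then dε else fun _ => 1) (if j = k then dε else fun _ => 1) ((e₂ (n := n)).symm i)) := by
  set ρ : {w : InfinitePlace E // w.IsReal} → GL (Fin n) ℝ := Pi.mulSingle (wOf k) ε *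
    Pi.mulSingle (⟨c⁻¹ • (wOf k).1, isReal_smul_iff.mpr (wOf k).2⟩ : {w : InfinitePlace E // w.IsReal}) ε with hρdef
  -- `ρ` is diagonal-valued with `±1`-type entries
  have hdiag := fun w => pair_apply_eq_diagonal F E c wOf eκ he₁ he₂ ε dε hεd k w
  choose δ hδ1 hδ2 using hdiag
  have hrσ := map_conjMixed_signPatternGL_pair F E c wOf eκ he₁ he₂ hcc ε k
  have hrS := transpose_mul_mul_signPatternGL_of_diagonal F E e dV dW δ
    (fun w i => by rcases hδ1 w i with h | h <;> rw [h]; exacts [hdε i, one_mul 1]) ρ hδ2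
  rw [map_evalR_leviCayley_of_orthogonal F E c e (Matrix.diagonal dV) hdV (Matrix.diagonal dW) hdW mA h2 ρ hrσ hrS (wOf j)]
  obtain ⟨h1, -⟩ := pair_apply F E c wOf eκ he₁ he₂ ε j k
  have hρj : ((ρ (wOf j) : GL (Fin n) ℝ) : Matrix (Fin n) (Fin n) ℝ) = Matrix.diagonal (if j = k then dε else fun _ => 1) := by
    rw [hρdef, h1]
    by_cases hjk : j = k
    · rw [if_pos hjk, if_pos hjk, hεd]
    · rw [if_neg hjk, if_neg hjk, Units.val_one, Matrix.diagonal_one]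
  rw [hρj, Matrix.fromBlocks_diagonal, Matrix.reindex_apply, Matrix.submatrix_diagonal_equiv]
  rfl

omit [NumberField F] [NumberField E] [Algebra.IsQuadraticExtension F E] in
include he₁ he₂ in
/-- **the pair representative at DIAGONAL Gram data, complex coordinates**: `(q₀ k)_w = 1` for every complex place `w` of `E`
(the `hC` datum of `conj_archWeilSection3D_apply_zero_of_sign`). [cite: Kudla1994, §3] [cite: HarrisKudlaSweet1996, §1 (1.11)] -/
theorem map_evalC_leviCayley_pair (hcc : c * c = 1) (hdV : IsUnit (Matrix.diagonal dV).det) (hdW : IsUnit (Matrix.diagonal dW).det)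
    (mA : GL (Fin n) (mixedSpace E) →* arch F E c (n + n) (hermD F E e (Matrix.diagonal dV) (Matrix.diagonal dW)))
    (h2 : ∀ r, (2 : mixedSpace E) • Matrix.reindex (e₂ (n := n)).symm (e₂ (n := n)).symm
        (((mA r : arch F E c (n + n) (hermD F E e (Matrix.diagonal dV) (Matrix.diagonal dW))) : GL (Fin (n + n)) (mixedSpace E)) :
          Matrix (Fin (n + n)) (Fin (n + n)) (mixedSpace E)) =
      Matrix.fromBlocks (1 : Matrix (Fin n) (Fin n) (mixedSpace E)) 1 1 (-1) *
        Matrix.fromBlocks (r : Matrix (Fin n) (Fin n) (mixedSpace E)) 0 0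
          ((((gramR F e (Matrix.diagonal dV) (Matrix.diagonal dW)).map (algebraMap F E)).map (mixedEmbedding E) +
              ((gramR F e (Matrix.diagonal dV) (Matrix.diagonal dW)).map (algebraMap F E)).map (mixedEmbedding E))⁻¹ *
            (((r⁻¹ : GL (Fin n) (mixedSpace E)) : Matrix (Fin n) (Fin n) (mixedSpace E)).map (conjMixed F E c))ᵀ *
            (((gramR F e (Matrix.diagonal dV) (Matrix.diagonal dW)).map (algebraMap F E)).map (mixedEmbedding E) +
              ((gramR F e (Matrix.diagonal dV) (Matrix.diagonal dW)).map (algebraMap F E)).map (mixedEmbedding E))) *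
        Matrix.fromBlocks (1 : Matrix (Fin n) (Fin n) (mixedSpace E)) 1 1 (-1))
    (ε : GL (Fin n) ℝ) (dε : Fin n → ℝ) (hεd : ((ε : GL (Fin n) ℝ) : Matrix (Fin n) (Fin n) ℝ) = Matrix.diagonal dε)
    (hdε : ∀ i, dε i * dε i = 1) (k : κ) (w : {w : InfinitePlace E // w.IsComplex}) :
    (((mA (signPatternGL E (Pi.mulSingle (wOf k) ε *
        Pi.mulSingle (⟨c⁻¹ • (wOf k).1, isReal_smul_iff.mpr (wOf k).2⟩ : {w : InfinitePlace E // w.IsReal}) ε)) :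
          arch F E c (n + n) (hermD F E e (Matrix.diagonal dV) (Matrix.diagonal dW))) : GL (Fin (n + n)) (mixedSpace E)) :
          Matrix (Fin (n + n)) (Fin (n + n)) (mixedSpace E)).map (evalC E w) = 1 := by
  set ρ : {w : InfinitePlace E // w.IsReal} → GL (Fin n) ℝ := Pi.mulSingle (wOf k) ε *
    Pi.mulSingle (⟨c⁻¹ • (wOf k).1, isReal_smul_iff.mpr (wOf k).2⟩ : {w : InfinitePlace E // w.IsReal}) ε with hρdef
  have hdiag := fun w => pair_apply_eq_diagonal F E c wOf eκ he₁ he₂ ε dε hεd k w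
  choose δ hδ1 hδ2 using hdiag
  have hrσ := map_conjMixed_signPatternGL_pair F E c wOf eκ he₁ he₂ hcc ε k
  have hrS := transpose_mul_mul_signPatternGL_of_diagonal F E e dV dW δ
    (fun w i => by rcases hδ1 w i with h | h <;> rw [h]; exacts [hdε i, one_mul 1]) ρ hδ2
  exact map_evalC_leviCayley_of_orthogonal F E c e (Matrix.diagonal dV) hdV (Matrix.diagonal dW) hdW mA h2 ρ hrσ hrS w

end Diagonal

end Literature.NumberTheory.GelbartRogawski1991.GRConstructionGen

end
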